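import Summits.BirchSwinnertonDyer.BirchSwinnertonDyer.Theorems.EisensteinPrimesIndexInputsH2
import Summits.BirchSwinnertonDyer.BirchSwinnertonDyer.Theorems.EisensteinPrimesWeakLeopoldtAboveCharModuleAtOfTateTC
import Summits.BirchSwinnertonDyer.BirchSwinnertonDyer.Theorems.EisensteinPrimesWeakLeopoldtAboveCurveOfTateTC
import Literature.NumberTheory.IwasawaTheory.Greenberg2006.CohomologyCofiniteGenerationLeTwoOfTateTC
import HarnessLib

/-!
# T28b re-typing (`OfTateTC`: Tate's formula by name AT TOTALLY COMPLEX FIELDS) of `EisensteinPrimesIndexInputsH2.lean`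

Route `EisensteinPrimes` (rung K5), crux 2 `GoodLatticeBDPValue` (stmt-BirchSwinnertonDyer-19032), line `halves`;
cell `bsd-eis`, seat `bsd-line-x1-p1` LEAD g8, lane «T28 / TATE RE-PLUMB» (helper, `--supports`).

This file re-types, token for token, the theorems of `EisensteinPrimesIndexInputsH2` that carry
Greenberg 2006 Prop. 3.2 BY NAME (`h32 : (∀ (L : Type) [Field L] [NumberField L] [IsTotallyComplex L], Literature.NumberTheory.GaloisCohomology.tateGlobalEulerPoincareCharacteristic L)`, cofinite generation of
`Hⁱ(K_Σ/K, 𝒟)` / `Hⁱ(K_v, 𝒟)` for EVERY `i`, every number field, every prime) with that hypothesis replaced by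
Tate's global Euler–Poincaré characteristic BY NAME AT TOTALLY COMPLEX FIELDS
(`h32 : ∀ L [IsTotallyComplex L], GaloisCohomology.tateGlobalEulerPoincareCharacteristic L`, Milne ADT I Thm. 5.1 — the shape the
tree's class-formation road to Tate's theorem delivers; where a theorem's field was not syntactically totally complex an
`[IsTotallyComplex K]` binder is added and supplied by its callers from `IsImaginaryQuadratic K` / `∀ w, w.IsComplex`): on this line
Prop. 3.2 is read in degrees `i ≤ 2` only (global clause; the local clause is the unconditional
`Greenberg2006.prop32_local_holds`), and in those degrees it follows from Tate's formula alone
(`Greenberg2006.prop32_global_le_two_of_tate_tc`, file `CohomologyCofiniteGenerationLeTwoOfTateTC`: `H⁰`/`H¹` of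
`G_{K,S}` with finite coefficients are finite unconditionally, `H²` by Tate, and Greenberg's dévissage for `Hⁿ`
involves `Hⁿ`, `Hⁿ⁻¹` only).  Statements are otherwise VERBATIM (same binder order, new names `<name>_ofTateTC`; supersedes this seat's `…OfTate` twin, which took Tate's formula at every number field);
proofs are the tree proofs with the two reading lemmas substituted and the re-typed callees called.
EFFECT for the crux: Harari Thm. 17.13 (a) (`poitouTate_restricted_three_le`) is no longer consumed through
Prop. 3.2 at every number field, only at totally complex fields (Greenberg 2006 Prop. 4.1 is typed totally
imaginary; `cd_p ≤ 2` and the `H²` bookkeeping at the imaginary quadratic `K`), which is what the tree's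
class-formation road (`RestrictedRamificationCdTwoOfH3Mu`, lane PT3-TC) proves.

Theorems only; no definition, no named fact, no `sorry`, no instance. HONEST FRAMING: conditional on the PUBLISHED
named facts carried as hypotheses; closes nothing by itself; no summit statement / BSD / the crux is proved here.

## References
* R. Greenberg, *On the structure of certain Galois cohomology groups*, Doc. Math. Extra Vol. Coates (2006), Prop. 3.2 (p. 358). [Greenberg2006]
* J. S. Milne, *Arithmetic Duality Theorems*, 2nd ed. (2006), I Thm. 5.1 (p. 67). [MilneADT2006]
* (the references of the re-typed file apply verbatim)
-/

set_option autoImplicit false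

noncomputable section

open scoped Classical
open Function NumberField IsDedekindDomain Field WeierstrassCurve
open Literature.NumberTheory.EllipticCurves Literature.NumberTheory.EllipticCurves.GreenbergSelmer
  Literature.NumberTheory.EllipticCurves.GreenbergVatsal2000 Literature.NumberTheory.GaloisRepresentations
  Literature.NumberTheory.GaloisCohomology
  Literature.NumberTheory.EllipticCurves.KellerYin2024 Literature.NumberTheory.EllipticCurves.IwasawaDual
  Literature.NumberTheory.IwasawaTheory Literature.NumberTheory.IwasawaTheory.Greenberg2016
  Literature.NumberTheory.IwasawaTheory.Greenberg2006
  Summit.BirchSwinnertonDyer.Rank1Residual.X2.ResidualDevissageModules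
  Summit.BirchSwinnertonDyer.BirchSwinnertonDyer.Theorems.GreenbergFullAtSelmer
  Summit.BirchSwinnertonDyer.BirchSwinnertonDyer.Theorems.AcTwistDeformationResidualPair
  Summit.BirchSwinnertonDyer.BirchSwinnertonDyer.Theorems.UnramifiedInflation

namespace Summit.BirchSwinnertonDyer.BirchSwinnertonDyer.Theorems.IndexInputsH2

variable {K : Type} [Field K] [NumberField K] {p : ℕ} [Fact p.Prime]

/-- **[T28b `OfTateTC` re-typing: Greenberg 2006 Prop. 3.2 by name ↦ Milne ADT I Thm. 5.1 by name AT TOTALLY COMPLEX FIELDS (Prop. 3.2 is read in degrees ≤ 2 and at totally complex fields only, `prop32_global_le_two_of_tate_tc`).]** [cite: MilneADT2006, I Thm. 5.1 (p. 67)] **The `H²` bookkeeping conjunct `hH2` of halves v20.1 `stub_indexInputs`, in the crux's binders, modulo PUB.** For `E = W/ℚ`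
base-changed to the imaginary quadratic `K` with (Heeg) for `N_E`, `2 < p = v v̄` split (`v` through `ι`, `v̄ ≠ v`), `κ`
anticyclotomic with topological generator `γ` (`K_∞ = K̄^{ker κ}`), a residual pair `θsub, θquot` of `E[p]` over `K`, `Sf` = the
places over `N_E`, halves v20.1's cotorsion clauses `hSsub` / `hSquot` ([PWL-θ], VERBATIM), and for EVERY `Γ_K`-stable
`Φ ≤ E_K[p]` with equivariant injective Kummer maps `j₁ : Φ ↪ (F/𝒪)(θsub)`, `j₃ : E_K[p]/Φ ↪ (F/𝒪)(θquot)` onto the `p`-torsion: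
GRANTED Greenberg 2006 Props. 4.1, 4.2, §5 A, 3.2 and `cd_p(G_{K,Σ}) ≤ 2` BY NAME,
`[U(E_K[p]/Φ) : q_* U(E_K[p])] · #(U(E_K[p^∞])/p) = #(U((F/𝒪)(θsub))/p) · #(U((F/𝒪)(θquot))/p)` with
`U(·) = unramifiedOutside (ker κ) · p ↑Sf` — the last conjunct of `stub_indexInputs` (l.342–348) VERBATIM. Proof: (F)
`natCard_H2bookkeeping_unramifiedOutside_insert_insert` at the §1 descents, weak Leopoldt from w2 gen 4's
`subsingleton_H_two_above_geomPrimaryTorsion_ofTateTC` / `subsingleton_H_two_above_charModule_of_cotorsion_at_ofTateTC`.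
[cite: KellerYin2024, §1.4 (proof of Thm. 1.4.1 (iii), arXiv:2402.12781v2 TeX L1183–1330)] [cite: Greenberg2006, Thm. 3 p. 342, Props. 3.2, 4.1–4.2, §5 A]
[cite: NeukirchSchmidtWingberg2008, (8.3.18)] [cite: Harari2020, Cor. 17.14 (p. 295)] -/
theorem natCard_H2_conjunct_ofTateTC (hCD2 : groupCdLE_two_galoisGroupUnramifiedOutside K)
    (h41 : prop41_globalEulerPoincareCorank) (h42 : prop42_localEulerPoincareCorank)
    (h5A : sec5A_localH2_subsingleton_of_LOC1) (h32 : (∀ (L : Type) [Field L] [NumberField L] [IsTotallyComplex L], Literature.NumberTheory.GaloisCohomology.tateGlobalEulerPoincareCharacteristic L))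
    (W : WeierstrassCurve ℚ) [W.IsElliptic] (hp : 2 < p) (hK : IsImaginaryQuadratic K)
    (hH : SatisfiesHeegnerHypothesis (W.conductorNorm ℤ) K)
    {ι : K →+* ℚ_[p]} {v vbar : HeightOneSpectrum (𝓞 K)}
    (hvι : ∀ x : 𝓞 K, x ∈ v.asIdeal ↔ ‖ι (x : K)‖ < 1)
    (hvbar : ((p : ℕ) : 𝓞 K) ∈ vbar.asIdeal) (hne : vbar ≠ v)
    (κ : ZpExtension K p) (hκ : κ.IsAnticyclotomic) (γ : absoluteGaloisGroup K) [Fact (κ.IsTopGenerator γ)]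
    {θsub θquot : FramedGaloisRep K (padicCoeffIntegers (∅ : Set (PadicAlgCl p))) 1}
    (hpair : IsResidualPairOver (W.baseChange K) p θsub θquot)
    (Sf : Finset (HeightOneSpectrum (𝓞 K)))
    (hSf : ∀ w : HeightOneSpectrum (𝓞 K), w ∈ Sf ↔ ((W.conductorNorm ℤ : ℤ) : 𝓞 K) ∈ w.asIdeal)
    (hSsub : ∀ D : DatumDualData κ γ (charModule (∅ : Set (PadicAlgCl p)) θsub)
      (Castella2018.AcSelmer.bdpData (charModule (∅ : Set (PadicAlgCl p)) θsub) p vbar) (↑Sf : Set (HeightOneSpectrum (𝓞 K))),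
      Module.Finite (IwasawaAlgebra p) D.X ∧ Module.IsTorsion (IwasawaAlgebra p) D.X ∧ muInvariant p D.X = 0)
    (hSquot : ∀ D : DatumDualData κ γ (charModule (∅ : Set (PadicAlgCl p)) θquot)
      (Castella2018.AcSelmer.bdpData (charModule (∅ : Set (PadicAlgCl p)) θquot) p vbar) (↑Sf : Set (HeightOneSpectrum (𝓞 K))),
      Module.Finite (IwasawaAlgebra p) D.X ∧ Module.IsTorsion (IwasawaAlgebra p) D.X ∧ muInvariant p D.X = 0)
    (Φ : StableSubgroup (absoluteGaloisGroup K) ↥((W.baseChange K).geomTorsion (p : ℤ)))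
    (j₁ : Φ.Sub →+ charModule (∅ : Set (PadicAlgCl p)) θsub) (j₃ : Φ.Quot →+ charModule (∅ : Set (PadicAlgCl p)) θquot)
    (hj₁ : ∀ (g : absoluteGaloisGroup K) (a : Φ.Sub), j₁ (g • a) = g • j₁ a)
    (hj₃ : ∀ (g : absoluteGaloisGroup K) (a : Φ.Quot), j₃ (g • a) = g • j₃ a)
    (hj₁inj : Injective j₁) (hj₃inj : Injective j₃)
    (hr₁ : ∀ x : charModule (∅ : Set (PadicAlgCl p)) θsub, x ∈ j₁.range ↔ p • x = 0)
    (hr₃ : ∀ x : charModule (∅ : Set (PadicAlgCl p)) θquot, x ∈ j₃.range ↔ p • x = 0) :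
    Nat.card (↥(unramifiedOutside κ.kerSubgroup Φ.Quot p (↑Sf : Set (HeightOneSpectrum (𝓞 K)))) ⧸
        ((unramifiedOutside κ.kerSubgroup ↥((W.baseChange K).geomTorsion (p : ℤ)) p (↑Sf : Set (HeightOneSpectrum (𝓞 K)))).map
          (resH1Hom (ContinuousMonoidHom.id ↥κ.kerSubgroup) Φ.proj
            (fun g b ↦ Φ.proj_smul (g : absoluteGaloisGroup K) b))).addSubgroupOf
              (unramifiedOutside κ.kerSubgroup Φ.Quot p (↑Sf : Set (HeightOneSpectrum (𝓞 K))))) *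
        Nat.card (ModN (unramifiedOutside κ.kerSubgroup ↥((W.baseChange K).geomPrimaryTorsion p) p
          (↑Sf : Set (HeightOneSpectrum (𝓞 K)))) p) =
      Nat.card (ModN (unramifiedOutside κ.kerSubgroup (charModule (∅ : Set (PadicAlgCl p)) θsub) p
          (↑Sf : Set (HeightOneSpectrum (𝓞 K)))) p) *
        Nat.card (ModN (unramifiedOutside κ.kerSubgroup (charModule (∅ : Set (PadicAlgCl p)) θquot) p
          (↑Sf : Set (HeightOneSpectrum (𝓞 K)))) p) := by
  haveI hEK : (W.baseChange K).IsElliptic := inferInstanceAs (W.map (algebraMap ℚ K)).IsElliptic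
  have hv : ((p : ℕ) : 𝓞 K) ∈ v.asIdeal := IwasawaTwoVariable.natCast_mem_asIdeal_of_norm_iff hvι
  -- the places `Σ = {v, v̄} ∪ Sf ⊇ Sf ∪ {w ∣ p}`
  have hS : ∀ w : HeightOneSpectrum (𝓞 K), ((p : ℕ) : 𝓞 K) ∈ w.asIdeal →
      w ∈ (↑(insert v (insert vbar Sf)) : Set (HeightOneSpectrum (𝓞 K))) :=
    mem_insert_insert_of_natCast_mem hK hv hvbar hne Sf
  have hSfS : ∀ w ∈ Sf, w ∈ (↑(insert v (insert vbar Sf)) : Set (HeightOneSpectrum (𝓞 K))) := fun w hw ↦ by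
    rw [Finset.coe_insert, Finset.coe_insert]
    exact Or.inr (Or.inr (Finset.mem_coe.mpr hw))
  -- §1: the three descents
  obtain ⟨ρA₁, hρA₁⟩ := exists_descent_charModule W hpair Sf hSf _ hSfS hS θsub (Or.inl rfl)
  obtain ⟨ρA₃, hρA₃⟩ := exists_descent_charModule W hpair Sf hSf _ hSfS hS θquot (Or.inr rfl)
  obtain ⟨ρA₂, hρA₂⟩ := exists_descent_geomPrimaryTorsion (p := p) W Sf hSf _ hSfS hS
  -- weak Leopoldt above `K_∞` for the three descents (w2 gen 4)
  haveI : ContinuousSMul ℤ (charModule (∅ : Set (PadicAlgCl p)) θsub) := ⟨continuous_of_discreteTopology⟩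
  haveI : ContinuousSMul ℤ (charModule (∅ : Set (PadicAlgCl p)) θquot) := ⟨continuous_of_discreteTopology⟩
  haveI : ContinuousSMul ℤ ↥((W.baseChange K).geomPrimaryTorsion p) := ⟨continuous_of_discreteTopology⟩
  have hWL₁ : Subsingleton ((ρA₁.restrict
      (galoisGroupAboveSubtype (↑(insert v (insert vbar Sf)) : Set (HeightOneSpectrum (𝓞 K))) κ.kerSubgroup)).H 2) :=
    WeakLeopoldtAboveCharModuleAt.subsingleton_H_two_above_charModule_of_cotorsion_at_ofTateTC hCD2 h41 h42 h5A h32 W hp hK hH hvι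
      hvbar hne κ hκ γ hpair Sf hSf θsub (Or.inl rfl) hSsub ρA₁ hρA₁
  have hWL₃ : Subsingleton ((ρA₃.restrict
      (galoisGroupAboveSubtype (↑(insert v (insert vbar Sf)) : Set (HeightOneSpectrum (𝓞 K))) κ.kerSubgroup)).H 2) :=
    WeakLeopoldtAboveCharModuleAt.subsingleton_H_two_above_charModule_of_cotorsion_at_ofTateTC hCD2 h41 h42 h5A h32 W hp hK hH hvι
      hvbar hne κ hκ γ hpair Sf hSf θquot (Or.inr rfl) hSquot ρA₃ hρA₃
  have hWL₂ : Subsingleton ((ρA₂.restrict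
      (galoisGroupAboveSubtype (↑(insert v (insert vbar Sf)) : Set (HeightOneSpectrum (𝓞 K))) κ.kerSubgroup)).H 2) :=
    WeakLeopoldtAboveCurve.subsingleton_H_two_above_geomPrimaryTorsion_ofTateTC hCD2 h41 h42 h5A h32 W hp hK hH hvι hvbar hne κ hκ γ
      hpair Sf hSf hSsub hSquot ρA₂ hρA₂
  -- the residual / Kummer data of (F)
  have hexact : ∀ b : ↥((W.baseChange K).geomTorsion (p : ℤ)), Φ.proj b = 0 → ∃ a : Φ.Sub, Φ.incl a = b :=
    fun b hb ↦ Φ.mem_range_incl_of_proj_eq_zero b hb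
  exact natCard_H2bookkeeping_unramifiedOutside_insert_insert hK hv hvbar hne Sf κ Φ.incl Φ.proj Φ.incl_smul Φ.proj_smul
    Φ.incl_injective Φ.proj_surjective hexact Φ.proj_incl
    j₁ (AddSubgroup.inclusion (geomTorsion_le_geomPrimaryTorsion (W.baseChange K) p)) j₃ hj₁ (fun _ _ ↦ rfl) hj₃
    hj₁inj (AddSubgroup.inclusion_injective _) hj₃inj
    hr₁ (IndexInputsH0.mem_range_inclusion_iff_nsmul_eq_zero W) hr₃
    (CharResidualSelmerCount.charModule_divisible θsub) (IndexInputsH0.exists_nsmul_eq_primaryTorsion W)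
    (CharResidualSelmerCount.charModule_divisible θquot)
    (Φ.continuous_smul_sub (continuous_smul_geomTorsion (W.baseChange K) (p : ℤ)))
    (continuous_smul_geomTorsion (W.baseChange K) (p : ℤ))
    (Φ.continuous_smul_quot (continuous_smul_geomTorsion (W.baseChange K) (p : ℤ)))
    ρA₁ ρA₂ ρA₃ hρA₁ hρA₂ hρA₃ hWL₁ hWL₂ hWL₃ hCD2

end Summit.BirchSwinnertonDyer.BirchSwinnertonDyer.Theorems.IndexInputsH2

end
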